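import Mathlib
import Literature.MathematicalPhysics.QuantumLattice.GrassmannIntegralProofs
import Literature.MathematicalPhysics.QuantumLattice.WilsonDiracAP
import HarnessLib

/-!
# The Wilson–Dirac operator in a `γ₀`-diagonal spin basis (helper for `BackgroundSchwarz`)

The site-reflection positivity of `r = 1` Wilson fermions (Montvay–Münster §4.2.3,
(4.100)–(4.111)) splits the spinor at every site into the `γ₀ = +1` components `ξ` and the
`γ₀ = -1` components `η` ((4.102)).  The tree's `euclideanGamma 0 = σʸ ⊗ σˣ` is not diagonal, so
we conjugate the Wilson–Dirac operator by the spin matrix `𝐒` (`𝐒 𝐒ᴴ = 2`, `𝐒 γ₀ 𝐒ᴴ = 2 diag(1,1,-1,-1)`):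
`spinorLift 𝐒 · D_W[U] · spinorLift 𝐒ᴴ = 2 · D'[U]`, where `D'[U] = (m+4)·1 + Σ_μ (H⁺'_μ + H⁻'_μ)`
has the rotated hopping matrices with spin factors `rotF[μ] = -¼ 𝐒 (1 - γ_μ) 𝐒ᴴ`,
`rotG[μ] = -¼ 𝐒 (1 + γ_μ) 𝐒ᴴ`; in particular `det D_W[U] = det D'[U]` (`det_wilsonDirac_eq_det_rot`).
Objects are introduced as notations (no new definitions).
-/

noncomputable section

namespace Summit.QuantumFields.QCD.Theorems.BackgroundSchwarz

open Matrix Complex Finset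
open Literature.MathematicalPhysics.QuantumLattice Literature.MathematicalPhysics.QuantumFieldTheory
  Literature.Probability.LatticeModels
open scoped Kronecker

set_option quotPrecheck false in
/-- The spin rotation `𝐒` (rows: `√2 ×` the conjugate eigenvectors of `γ₀ = σʸ ⊗ σˣ`, eigenvalues
`+1, +1, -1, -1`). -/
scoped notation "rot𝐒" =>
  (!![1, 0, 0, -Complex.I; 0, 1, -Complex.I, 0; 1, 0, 0, Complex.I; 0, 1, Complex.I, 0] :
    Matrix (Fin 4) (Fin 4) ℂ)

/-- The rotated forward spin factor `-¼ 𝐒 (1 - γ_μ) 𝐒ᴴ` (`= -½ · Ω(1-γ_μ)Ω⁻¹` for the unitary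
`Ω = 𝐒/√2`). -/
scoped notation "rotF[" μ "]" =>
  ((-(1 / 4 : ℂ)) • (rot𝐒 * ((1 : Matrix (Fin 4) (Fin 4) ℂ) -
    Literature.MathematicalPhysics.QuantumLattice.euclideanGamma μ) * (rot𝐒)ᴴ))

set_option quotPrecheck false in
/-- The rotated backward spin factor `-¼ 𝐒 (1 + γ_μ) 𝐒ᴴ`. -/
scoped notation "rotG[" μ "]" =>
  ((-(1 / 4 : ℂ)) • (rot𝐒 * ((1 : Matrix (Fin 4) (Fin 4) ℂ) +
    Literature.MathematicalPhysics.QuantumLattice.euclideanGamma μ) * (rot𝐒)ᴴ))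

set_option quotPrecheck false in
/-- The rotated forward hopping matrix `(x,a,α; y,b,β) ↦ [y = x + μ̂] rotF[μ]_{αβ} ρ(U(x,μ))_{ab}`. -/
scoped notation "rotHopF[" ρ ", " U ", " μ "]" =>
  (Matrix.of fun (p q : Literature.Probability.LatticeModels.TorusSite 4 _ × Fin _ × Fin 4) =>
    if q.1 = Literature.MathematicalPhysics.QuantumFieldTheory.Site.shift p.1 μ then
      (rotF[μ]) p.2.2 q.2.2 * (ρ (U (p.1, μ)) : Matrix (Fin _) (Fin _) ℂ) p.2.1 q.2.1 else 0)

set_option quotPrecheck false in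
/-- The rotated backward hopping matrix `(x,a,α; y,b,β) ↦ [x = y + μ̂] rotG[μ]_{αβ} ρ(U(y,μ)⁻¹)_{ab}`. -/
scoped notation "rotHopB[" ρ ", " U ", " μ "]" =>
  (Matrix.of fun (p q : Literature.Probability.LatticeModels.TorusSite 4 _ × Fin _ × Fin 4) =>
    if p.1 = Literature.MathematicalPhysics.QuantumFieldTheory.Site.shift q.1 μ then
      (rotG[μ]) p.2.2 q.2.2 * (ρ (U (q.1, μ))⁻¹ : Matrix (Fin _) (Fin _) ℂ) p.2.1 q.2.1 else 0)

set_option quotPrecheck false in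
/-- The rotated Wilson–Dirac operator `D'[U] = (m+4)·1 + Σ_μ (H⁺'_μ + H⁻'_μ)` (`r = 1`). -/
scoped notation "rotD[" ρ ", " U ", " m "]" =>
  ((((m + 4 : ℝ) : ℂ) • (1 : Matrix (Literature.Probability.LatticeModels.TorusSite 4 _ × Fin _ × Fin 4)
      (Literature.Probability.LatticeModels.TorusSite 4 _ × Fin _ × Fin 4) ℂ) +
    ∑ μ : Fin 4, (rotHopF[ρ, U, μ] + rotHopB[ρ, U, μ]) :
    Matrix (Literature.Probability.LatticeModels.TorusSite 4 _ × Fin _ × Fin 4)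
      (Literature.Probability.LatticeModels.TorusSite 4 _ × Fin _ × Fin 4) ℂ))


/-! ## Notation for the objects inlined in the item `BackgroundSchwarz` -/

/-- The spin index with sign block `σ` (`0 ↔ γ₀' = +1`, `1 ↔ γ₀' = -1`) and component `s`. -/
scoped notation "spin4[" σ ", " s "]" => ((![![(0 : Fin 4), 1], ![2, 3]] : Fin 2 → Fin 2 → Fin 4) σ s)

set_option quotPrecheck false in
/-- The all-directions antiperiodic sign twist of a `U(N)` field on the torus of side `L`
(the item's `fun e => if (e.1 e.2).val + 1 = L then -V e else V e`; seams at `x_μ = L - 1`). -/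
scoped notation "apTw[" L ", " V "]" =>
  (fun e : Literature.MathematicalPhysics.QuantumFieldTheory.Edge 4 L =>
    if (e.1 e.2).val + 1 = L then -V e else V e)

set_option quotPrecheck false in
/-- The site reflection `x₀ ↦ -x₀` in the hyperplanes `x₀ = 0, L/2` (the item's `θ`). -/
scoped notation "θsite[" x "]" => (Function.update x 0 (-(x 0)))

set_option quotPrecheck false in
/-- The site reflection on link fields (the item's `Θ`, = `GaugeConfig.negReflect`): time-like links
reversed and inverted, spatial links carried along. -/
scoped notation "Θcfg[" V "]" =>
  (fun e : Literature.MathematicalPhysics.QuantumFieldTheory.Edge 4 _ =>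
    if e.2 = 0 then
      (V (θsite[Literature.MathematicalPhysics.QuantumFieldTheory.Site.shift e.1 0], 0))⁻¹
    else V (θsite[e.1], e.2))

set_option quotPrecheck false in
/-- The closed positive half of the links (the item's `pos`): time-like links with `x₀ < L/2`,
spatial links with `x₀ ≤ L/2`. -/
scoped notation "posE[" L ", " e "]" =>
  (if e.2 = (0 : Fin 4) then (e.1 0 : ZMod L).val < L / 2 else (e.1 0 : ZMod L).val ≤ L / 2)

variable {L N : ℕ} [NeZero L] {G : Type*} [Group G] (ρ : G →* Matrix (Fin N) (Fin N) ℂ)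

/-- The spin lift `1 ⊗ 1 ⊗ Γ` at the index type of the torus of side `L` with `N` colours. -/
local notation "SL[" Γ "]" => (Literature.MathematicalPhysics.QuantumLattice.spinorLift Γ :
  Matrix (TorusSite 4 L × Fin N × Fin 4) (TorusSite 4 L × Fin N × Fin 4) ℂ)

/-! ## The spin matrix `𝐒` -/

/-- `𝐒 𝐒ᴴ = 2`. -/
theorem rotS_mul_conjTranspose : rot𝐒 * (rot𝐒)ᴴ = (2 : ℂ) • (1 : Matrix (Fin 4) (Fin 4) ℂ) := by
  ext i j
  fin_cases i <;> fin_cases j <;>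
    simp [Matrix.mul_apply, Fin.sum_univ_four, Matrix.conjTranspose_apply] <;> ring_nf

/-- `𝐒ᴴ 𝐒 = 2`. -/
theorem rotS_conjTranspose_mul : (rot𝐒)ᴴ * rot𝐒 = (2 : ℂ) • (1 : Matrix (Fin 4) (Fin 4) ℂ) := by
  ext i j
  fin_cases i <;> fin_cases j <;>
    simp [Matrix.mul_apply, Fin.sum_univ_four, Matrix.conjTranspose_apply] <;> ring_nf

/-! ## Spin lifts act on the spin index only -/

/-- Left multiplication by a spin lift. -/
theorem spinorLift_mul_apply {Y : Type*} (Γ : Matrix (Fin 4) (Fin 4) ℂ)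
    (A : Matrix (TorusSite 4 L × Fin N × Fin 4) Y ℂ) (p : TorusSite 4 L × Fin N × Fin 4) (q : Y) :
    (SL[Γ] * A) p q = ∑ β, Γ p.2.2 β * A (p.1, p.2.1, β) q := by
  classical
  rw [Matrix.mul_apply, Fintype.sum_prod_type, Finset.sum_eq_single p.1]
  · rw [Fintype.sum_prod_type, Finset.sum_eq_single p.2.1]
    · refine Finset.sum_congr rfl fun β _ => ?_
      simp [spinorLift, Matrix.kroneckerMap_apply]
    · intro b _ hb
      simp [spinorLift, Matrix.kroneckerMap_apply, Ne.symm hb]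
    · intro h; exact absurd (Finset.mem_univ _) h
  · intro x _ hx
    simp [spinorLift, Matrix.kroneckerMap_apply, Matrix.one_apply, Ne.symm hx]
  · intro h; exact absurd (Finset.mem_univ _) h

/-- Right multiplication by a spin lift. -/
theorem mul_spinorLift_apply {Y : Type*} (Γ : Matrix (Fin 4) (Fin 4) ℂ)
    (A : Matrix Y (TorusSite 4 L × Fin N × Fin 4) ℂ) (p : Y) (q : TorusSite 4 L × Fin N × Fin 4) :
    (A * SL[Γ]) p q = ∑ α, A p (q.1, q.2.1, α) * Γ α q.2.2 := by
  classical
  rw [Matrix.mul_apply, Fintype.sum_prod_type, Finset.sum_eq_single q.1]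
  · rw [Fintype.sum_prod_type, Finset.sum_eq_single q.2.1]
    · refine Finset.sum_congr rfl fun α _ => ?_
      simp [spinorLift, Matrix.kroneckerMap_apply]
    · intro b _ hb
      simp [spinorLift, Matrix.kroneckerMap_apply, hb]
    · intro h; exact absurd (Finset.mem_univ _) h
  · intro x _ hx
    simp [spinorLift, Matrix.kroneckerMap_apply, Matrix.one_apply, hx]
  · intro h; exact absurd (Finset.mem_univ _) h

/-- Spin lifts multiply: `(1⊗1⊗Γ)(1⊗1⊗Γ') = 1⊗1⊗(ΓΓ')`. -/
theorem spinorLift_mul_spinorLift (Γ Γ' : Matrix (Fin 4) (Fin 4) ℂ) :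
    SL[Γ] * SL[Γ'] = SL[Γ * Γ'] := by
  simp only [spinorLift, ← Matrix.mul_kronecker_mul, Matrix.mul_one]

omit [NeZero L] in
/-- The spin lift of a scalar matrix is a scalar. -/
theorem spinorLift_smul_one (c : ℂ) :
    SL[c • (1 : Matrix (Fin 4) (Fin 4) ℂ)] = c • 1 := by
  simp only [spinorLift, Matrix.kronecker_smul, Matrix.one_kronecker_one]

/-! ## Conjugating the hopping matrices -/

/-- `𝐒 H⁺_μ 𝐒ᴴ = -4 · H⁺'_μ`. -/
theorem spinorLift_mul_wilsonHopFwd_mul (U : GaugeConfig 4 L G) (μ : Fin 4) :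
    SL[rot𝐒] * wilsonHopFwd ρ U 1 μ * SL[(rot𝐒)ᴴ] = (-4 : ℂ) • rotHopF[ρ, U, μ] := by
  ext p q
  rw [mul_spinorLift_apply]
  simp_rw [spinorLift_mul_apply]
  by_cases h : q.1 = Site.shift p.1 μ
  · simp only [wilsonHopFwd, Matrix.of_apply, h, if_true, Matrix.smul_apply, smul_eq_mul,
      Complex.ofReal_one, one_smul, Matrix.mul_apply, Finset.sum_mul, Finset.mul_sum,
      Matrix.smul_apply]
    refine Finset.sum_congr rfl fun α _ => Finset.sum_congr rfl fun β _ => ?_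
    ring
  · simp [wilsonHopFwd, h]

/-- `𝐒 H⁻_μ 𝐒ᴴ = -4 · H⁻'_μ`. -/
theorem spinorLift_mul_wilsonHopBwd_mul (U : GaugeConfig 4 L G) (μ : Fin 4) :
    SL[rot𝐒] * wilsonHopBwd ρ U 1 μ * SL[(rot𝐒)ᴴ] = (-4 : ℂ) • rotHopB[ρ, U, μ] := by
  ext p q
  rw [mul_spinorLift_apply]
  simp_rw [spinorLift_mul_apply]
  by_cases h : p.1 = Site.shift q.1 μ
  · simp only [wilsonHopBwd, Matrix.of_apply, h, if_true, Matrix.smul_apply, smul_eq_mul,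
      Complex.ofReal_one, one_smul, Matrix.mul_apply, Finset.sum_mul, Finset.mul_sum,
      Matrix.smul_apply]
    refine Finset.sum_congr rfl fun α _ => Finset.sum_congr rfl fun β _ => ?_
    ring
  · simp [wilsonHopBwd, h]

omit [NeZero L] in
/-- Algebraic skeleton of the conjugation: if `P Q = 2` and `P H^±_μ Q = -4 H'^±_μ` then
`P ((c·1) - ½ Σ_μ (H⁺_μ + H⁻_μ)) Q = 2 (c·1 + Σ_μ (H'⁺_μ + H'⁻_μ))`. -/
theorem conj_wilson_aux {T : Type*} [Fintype T] [DecidableEq T] (P Q : Matrix T T ℂ)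
    (hPQ : P * Q = (2 : ℂ) • 1) (Hf Hb F B : Fin 4 → Matrix T T ℂ)
    (hF : ∀ μ, P * Hf μ * Q = (-4 : ℂ) • F μ) (hB : ∀ μ, P * Hb μ * Q = (-4 : ℂ) • B μ) (c : ℂ) :
    P * (c • (1 : Matrix T T ℂ) - (1 / 2 : ℂ) • ∑ μ, (Hf μ + Hb μ)) * Q =
      (2 : ℂ) • (c • (1 : Matrix T T ℂ) + ∑ μ, (F μ + B μ)) := by
  rw [Matrix.mul_sub, Matrix.sub_mul, Matrix.mul_smul, Matrix.smul_mul, Matrix.mul_one, hPQ,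
    Matrix.mul_smul, Matrix.smul_mul, Matrix.mul_sum, Matrix.sum_mul]
  simp_rw [Matrix.mul_add, Matrix.add_mul, hF, hB]
  rw [smul_add, Finset.smul_sum, Finset.smul_sum, sub_eq_add_neg, ← Finset.sum_neg_distrib]
  congr 1
  · rw [smul_smul, smul_smul, mul_comm]
  · refine Finset.sum_congr rfl fun μ _ => ?_
    module

/-- **The rotated Wilson–Dirac operator**: `𝐒 D_W[U] 𝐒ᴴ = 2 · D'[U]` (`r = 1`). -/
theorem spinorLift_mul_wilsonDirac_mul (U : GaugeConfig 4 L G) (m : ℝ) :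
    SL[rot𝐒] * wilsonDirac ρ U m 1 * SL[(rot𝐒)ᴴ] = (2 : ℂ) • rotD[ρ, U, m] := by
  rw [wilsonDirac_eq, mul_one]
  exact conj_wilson_aux _ _ (by rw [spinorLift_mul_spinorLift, rotS_mul_conjTranspose, spinorLift_smul_one])
    (wilsonHopFwd ρ U 1) (wilsonHopBwd ρ U 1) (fun μ => rotHopF[ρ, U, μ]) (fun μ => rotHopB[ρ, U, μ])
    (spinorLift_mul_wilsonHopFwd_mul ρ U) (spinorLift_mul_wilsonHopBwd_mul ρ U) _

/-- **`det D_W[U] = det D'[U]`** (`r = 1`): the determinant is unchanged by the spin rotation. -/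
theorem det_wilsonDirac_eq_det_rot (U : GaugeConfig 4 L G) (m : ℝ) :
    (wilsonDirac ρ U m 1).det = (rotD[ρ, U, m]).det := by
  have h := congrArg Matrix.det (spinorLift_mul_wilsonDirac_mul ρ U m)
  have hS : (SL[rot𝐒]).det * (SL[(rot𝐒)ᴴ]).det = (2 : ℂ) ^ Fintype.card (TorusSite 4 L × Fin N × Fin 4) := by
    rw [← det_mul, spinorLift_mul_spinorLift, rotS_mul_conjTranspose, spinorLift_smul_one, det_smul, det_one,
      mul_one]
  rw [det_mul, det_mul, det_smul] at h
  have h3 : (SL[rot𝐒]).det * (wilsonDirac ρ U m 1).det * (SL[(rot𝐒)ᴴ]).det =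
      (SL[rot𝐒]).det * (SL[(rot𝐒)ᴴ]).det * (wilsonDirac ρ U m 1).det := by ring
  rw [h3, hS] at h
  exact mul_left_cancel₀ (pow_ne_zero _ two_ne_zero) h

end Summit.QuantumFields.QCD.Theorems.BackgroundSchwarz
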